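import Summits.CriticalPhenomena.PercolationContinuityZ3.Theorems.Transplant.AutChartOrbitsOneLampNoGo
import Summits.CriticalPhenomena.PercolationContinuityZ3.Theorems.Transplant.GrigorchukLamplighterDefs
import Mathlib.GroupTheory.OrderOfElement
import HarnessLib

/-!
# SCOPE RECORD: the (N3-a) orbit theorem has NO designed transversal on Bartholdi–Erschler's own Cayley graph `Cay(ℤ ≀_X 𝔊; a, b, c, d, s)` — for EVERY
# finite-index subgroup of `Γ₂ = ℤ ≀_X 𝔊` acting by left multiplication, every transversal, character and scale (modulo Grigorchuk's torsion theorem, cited)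

builds on p205010 (kernel theorem, internal audit signed; external expert review pending) — nothing in this file uses p205010: it is a NEGATIVE (scope) record
about the hypotheses of the orbit theorem `CayleyCosets.conj4_of_cosetLetters` («AutChartOrbitsCayleyCosets» p580600), pure group theory, no percolation
statement.  Lane `prim-bschramm`, seat `prim-bschramm-p3` gen 35 (DESIGN OWNER; `run/shared/lean/prim/bschramm/P3-NILPOTENT.md` §28, located item L-p3g35-1).
Helper file (`--supports stmt-CriticalPhenomena-4575 --as helper`).  Def-free.  NOTHING is claimed about any `@[conjecture]` node, in particular nothing about
`BenjaminiSchramm1996_conj4_endState`; `θ(p_c) = 0` on `Cay(ℤ ≀_X 𝔊; a, b, c, d, s)` stays NOT PROVED in the tree and not in print.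

THE RECORD.  `P3-NILPOTENT.md` §26.6–§26.7 / VERDICTS V163 ADD. 6: for the STANDARD generating set `{a, b, c, d, s}` of `Γ₂ = ℤ ≀_X 𝔊` (ONE lamp letter) the
lane looked for a 'designed transversal' feeding the orbit theorem (N3-a) — a finite-index `Γ₀ ≤ Γ₂`, a right transversal `R`, a character `c : Γ₀ → ℤ²` and a
scale `N` with the four exact axis values `± N eᵢ` among the letter values at every representative — proved it impossible at relative unit scale and refuted a
grid of deeper designs by exact search ('census, not a theorem about all configurations').  HERE: impossible for ALL of them.  §1: the tree part of every
element of `Γ₂` lies in `𝔊` and is itself an element of `Γ₂`, so is the lamp part (`Grigorchuk.right_mem_grigorchukGroup`, `inr_right_mem_wreathZ`,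
`inl_left_mem_wreathZ`).  §2: **`Grigorchuk.wreathZ_not_cosetSteps_of_torsion`** — GIVEN Grigorchuk's theorem that `𝔊` is a torsion group, as the hypothesis
`∀ g ∈ grigorchukGroup, IsOfFinOrder g` (Grigorchuk 1980; it cannot be a `Literature` definition because `𝔊` is typed in a Transplant file, and its proof —
length contraction through the sections — is not typed), the letter-form step condition `hstep` of `conj4_of_cosetLetters` FAILS on `Γ₂ = Grigorchuk.wreathZ`
for EVERY finite set of letters each of which is a tree letter (lamp part trivial — `a, b, c, d`, or any element of the copy of `𝔊`) or the lamp letter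
`s = (ρ ↦ 1)`, every finite-index `Γ₀`, every finite right transversal, every `c`, every `N ≥ 1`: the instance `A` = lamp configurations (the kernel of the tree
projection; abelian, normal), `H` = the tree part (`≅ 𝔊`, torsion by the hypothesis), `A ⊓ H = ⊥`, `γ = (lamp part)·(tree part)` of the abstract ONE-LAMP NO-GO
`OneLampNoGo.not_cosetSteps` («AutChartOrbitsOneLampNoGo»).  §3 `wreathZ_standardGens_not_cosetSteps`: the literal standard set `{aW, bW, cW, dW, sW}`.
SCOPE, HONESTLY: (i) this closes the (N3-a) door for `Γ₂`'s standard generating set through subgroups OF `Γ₂`; finite-orbit subgroups of `Aut(Cay(Γ₂; S))` not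
consisting of left translations (caveat (α) of §26.5) are not addressed; (ii) the lamp-complete generating sets (two lamp letters, «GrigorchukLamplighterCritical
Continuity» p582067) are of course untouched — the no-go is exactly about ONE lamp letter; (iii) the remaining doors for `θ(p_c) = 0` on `Cay(Γ₂; a, b, c, d, s)`
are the quasi-step node's `hC` (laddered-line Aizenman–Grimmett kits, `P3-NILPOTENT.md` §27.3/27.8, HOLD) and, in print, a heat-kernel bound `p_n ≤ exp(−n^γ)`,
`γ > 1/2` (Hermon–Hutchcroft 2021) that nobody has computed for `ℤ ≀_X 𝔊`.
[cite: Grigorchuk1980, Theorem (every element of the group has finite order)] [cite: BartholdiErschler2012, §2 (permutational wreath products, standard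
generating set), §3.1 (the first Grigorchuk group)] [cite: BenjaminiSchramm1996, Conj. 4; §2 (Cayley graphs)]
-/

noncomputable section

namespace Summit.CriticalPhenomena.PercolationContinuityZ3.Theorems.Transplant

namespace Grigorchuk

open SemidirectProduct

/-! ## §1 Lamp part and tree part of an element of `Γ₂` -/

/-- **The tree part of every element of `Γ₂ = ℤ ≀_X 𝔊` lies in `𝔊`** (the tree projection maps the five generators into `{a, b, c, d, 1}`).
[cite: BartholdiErschler2012, §2 (W = Σ_X A ⋊ G)] -/
theorem right_mem_grigorchukGroup {γ : LampGroup ℤ} (hγ : γ ∈ wreathZ) : γ.right ∈ grigorchukGroup := by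
  have h : wreathZ.map (rightHom : LampGroup ℤ →* Equiv.Perm Ray) ≤ grigorchukGroup := by
    rw [wreathZ, MonoidHom.map_closure, Subgroup.closure_le]
    rintro _ ⟨x, hx, rfl⟩
    simp only [Set.mem_insert_iff, Set.mem_singleton_iff] at hx
    rcases hx with rfl | rfl | rfl | rfl | rfl
    · rw [tree, rightHom_inr]; exact Subgroup.subset_closure (by simp)
    · rw [tree, rightHom_inr]; exact Subgroup.subset_closure (by simp)
    · rw [tree, rightHom_inr]; exact Subgroup.subset_closure (by simp)
    · rw [tree, rightHom_inr]; exact Subgroup.subset_closure (by simp)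
    · rw [lamp, rightHom_inl]; exact grigorchukGroup.one_mem
  exact h ⟨γ, hγ, rfl⟩

/-- **Every element of `𝔊` is (the tree letter of) an element of `Γ₂`.** [cite: BartholdiErschler2012, §2 (the embedding g ↦ (1, g))] -/
theorem tree_mem_wreathZ {g : Equiv.Perm Ray} (hg : g ∈ grigorchukGroup) : (tree g : LampGroup ℤ) ∈ wreathZ := by
  have h : grigorchukGroup.map (inr : Equiv.Perm Ray →* LampGroup ℤ) ≤ wreathZ := by
    rw [grigorchukGroup, MonoidHom.map_closure]
    refine Subgroup.closure_mono ?_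
    rintro _ ⟨x, hx, rfl⟩
    simp only [Set.mem_insert_iff, Set.mem_singleton_iff] at hx
    rcases hx with rfl | rfl | rfl | rfl <;> simp [tree]
  exact h ⟨g, hg, rfl⟩

/-- The tree part of an element of `Γ₂`, as an element of the lamp group, lies in `Γ₂`. [cite: BartholdiErschler2012, §2] -/
theorem inr_right_mem_wreathZ {γ : LampGroup ℤ} (hγ : γ ∈ wreathZ) : (inr γ.right : LampGroup ℤ) ∈ wreathZ :=
  tree_mem_wreathZ (right_mem_grigorchukGroup hγ)

/-- The lamp part of an element of `Γ₂` lies in `Γ₂`. [cite: BartholdiErschler2012, §2] -/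
theorem inl_left_mem_wreathZ {γ : LampGroup ℤ} (hγ : γ ∈ wreathZ) : (inl γ.left : LampGroup ℤ) ∈ wreathZ := by
  have e : (inl γ.left : LampGroup ℤ) = γ * (inr γ.right)⁻¹ := by
    rw [eq_mul_inv_iff_mul_eq, inl_left_mul_inr_right]
  rw [e]
  exact wreathZ.mul_mem hγ (wreathZ.inv_mem (inr_right_mem_wreathZ hγ))

/-! ## §2 The no-go on `Γ₂ = ℤ ≀_X 𝔊` for one lamp letter, modulo Grigorchuk's torsion theorem -/

/-- **NO DESIGNED TRANSVERSAL ON `ℤ ≀_X 𝔊` WITH ONE LAMP LETTER (modulo Grigorchuk's torsion theorem).**  Assume every element of `𝔊` has finite order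
(`htor` — Grigorchuk 1980, cited, not typed).  Let `S ⊆ Γ₂` be a finite set of letters each of which has trivial lamp part (a tree letter: `a, b, c, d, …`) or is
the lamp letter `s = (ρ ↦ 1)`.  Then for every finite-index `Γ₀ ≤ Γ₂`, every finite right transversal `R`, every homomorphism `c : Γ₀ → ℤ²` and every `N ≥ 1` the
letter-form step condition of `CayleyCosets.conj4_of_cosetLetters` — at every representative all four exact values `± N eᵢ` among the `c a`, `r·x = a·r′`,
`x ∈ S ∪ S⁻¹` — FAILS: the orbit theorem (N3-a) has no input on `Cay(Γ₂; S)` built from a subgroup of `Γ₂`.  (Instance of `OneLampNoGo.not_cosetSteps` with `A` =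
the lamp configurations, `H` = the tree part.)  Lane record `P3-NILPOTENT.md` §28; supersedes the census of §26.7.
[cite: Grigorchuk1980, Theorem (every element of the group has finite order)] [cite: BartholdiErschler2012, §2 (standard generating set)] -/
theorem wreathZ_not_cosetSteps_of_torsion (htor : ∀ g ∈ grigorchukGroup, IsOfFinOrder g)
    (S : Finset ↥wreathZ) (hS : ∀ x ∈ S, ((x : ↥wreathZ) : LampGroup ℤ).left = 1 ∨ x = sW)
    (Γ₀ : Subgroup ↥wreathZ) [Γ₀.FiniteIndex] (R : Finset ↥wreathZ)
    (hRt : ∀ r ∈ R, ∀ r' ∈ R, ∀ a : Γ₀, (a : ↥wreathZ) * r = r' → r = r')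
    (hRc : ∀ g : ↥wreathZ, ∃ a : Γ₀, ∃ r ∈ R, (a : ↥wreathZ) * r = g)
    (c : Γ₀ →* Multiplicative (Fin 2 → ℤ)) (N : ℕ) (hN : 1 ≤ N)
    (hstep : ∀ r ∈ R, ∀ (i : Fin 2) (σ : ℤˣ), ∃ x : ↥wreathZ, (x ∈ S ∨ x⁻¹ ∈ S) ∧ ∃ (a : Γ₀) (r' : ↥wreathZ), r' ∈ R ∧
      r * x = (a : ↥wreathZ) * r' ∧ Multiplicative.toAdd (c a) = Pi.single i ((N : ℤ) * σ)) : False := by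
  classical
  -- the tree projection, the lamp subgroup `A` (its kernel) and the tree subgroup `H`
  let π : ↥wreathZ →* Equiv.Perm Ray := (rightHom : LampGroup ℤ →* Equiv.Perm Ray).comp wreathZ.subtype
  let A : Subgroup ↥wreathZ := π.ker
  let H : Subgroup ↥wreathZ := (inr : Equiv.Perm Ray →* LampGroup ℤ).range.comap wreathZ.subtype
  haveI hAn : A.Normal := MonoidHom.normal_ker π
  have memA : ∀ x : ↥wreathZ, x ∈ A ↔ ((x : LampGroup ℤ)).right = 1 := fun x => by
    simp only [A, π, MonoidHom.mem_ker, MonoidHom.coe_comp, Function.comp_apply, Subgroup.coe_subtype, rightHom_eq_right]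
  have memH : ∀ x : ↥wreathZ, x ∈ H ↔ ((x : LampGroup ℤ)).left = 1 := fun x => by
    simp only [H, Subgroup.mem_comap, Subgroup.coe_subtype, MonoidHom.mem_range]
    constructor
    · rintro ⟨g, hg⟩; rw [← hg, left_inr]
    · intro h; exact ⟨(x : LampGroup ℤ).right, SemidirectProduct.ext (by rw [left_inr, h]) (by rw [right_inr])⟩
  -- `A` is abelian
  have hA : ∀ x ∈ A, ∀ y ∈ A, x * y = y * x := by
    intro x hx y hy
    rw [memA] at hx hy
    refine Subtype.ext (SemidirectProduct.ext ?_ ?_)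
    · simp only [Subgroup.coe_mul, mul_left, hx, hy, map_one, MulAut.one_apply]
      exact mul_comm _ _
    · simp only [Subgroup.coe_mul, mul_right, hx, hy]
  -- `H` is torsion (Grigorchuk's theorem, transported along `inr`)
  have hH : ∀ t ∈ H, IsOfFinOrder t := by
    intro t ht
    obtain ⟨g, hg⟩ := (Subgroup.mem_comap.1 ht : ((t : ↥wreathZ) : LampGroup ℤ) ∈ (inr : Equiv.Perm Ray →* LampGroup ℤ).range)
    have hg' : (inr g : LampGroup ℤ) = (t : LampGroup ℤ) := hg
    have hgG : g ∈ grigorchukGroup := by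
      have := right_mem_grigorchukGroup t.2
      rwa [← hg', right_inr] at this
    obtain ⟨n, hn, hgn⟩ := (htor g hgG).exists_pow_eq_one
    refine isOfFinOrder_iff_pow_eq_one.2 ⟨n, hn, Subtype.ext ?_⟩
    rw [Subgroup.coe_pow, ← hg', ← map_pow, hgn, map_one, Subgroup.coe_one]
  -- `A ⊓ H = ⊥`
  have hAH : ∀ x ∈ A, x ∈ H → x = 1 := by
    intro x hx hx'
    rw [memA] at hx
    rw [memH] at hx'
    exact Subtype.ext (SemidirectProduct.ext (by rw [hx', Subgroup.coe_one, one_left]) (by rw [hx, Subgroup.coe_one, one_right]))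
  -- the decomposition `γ = (lamp part) · (tree part)` inside `Γ₂`
  let lam : ↥wreathZ → ↥wreathZ := fun γ => ⟨inl ((γ : LampGroup ℤ)).left, inl_left_mem_wreathZ γ.2⟩
  let tr : ↥wreathZ → ↥wreathZ := fun γ => ⟨inr ((γ : LampGroup ℤ)).right, inr_right_mem_wreathZ γ.2⟩
  have hlam : ∀ γ, lam γ ∈ A := fun γ => (memA _).2 (by simp [lam])
  have htr : ∀ γ, tr γ ∈ H := fun γ => (memH _).2 (by simp [tr])
  have hdec : ∀ γ, lam γ * tr γ = γ := fun γ => Subtype.ext (by simp [lam, tr, inl_left_mul_inr_right])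
  -- the lamp letter and the letters
  have hsA : sW ∈ A := (memA _).2 (by simp [sW])
  have hS' : ∀ x ∈ S, x ∈ H ∨ x = sW := fun x hx => (hS x hx).imp (fun h => (memH x).2 h) id
  exact OneLampNoGo.not_cosetSteps A H hA hH hAH lam tr hlam htr hdec sW hsA S hS' Γ₀ R hRt hRc c N hN hstep

/-! ## §3 Bartholdi–Erschler's standard generating set -/

/-- **Bartholdi–Erschler's own Cayley graph `Cay(ℤ ≀_X 𝔊; a, b, c, d, s)`: the orbit theorem's designed-transversal input does not exist** — for every
finite-index `Γ₀ ≤ Γ₂`, every finite right transversal, every `c : Γ₀ → ℤ²`, every scale (modulo Grigorchuk's torsion theorem `htor`, cited).  The literal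
standard generating set `{aW, bW, cW, dW, sW}` of «GrigorchukLamplighterDefs».  `θ(p_c) = 0` on this graph stays NOT PROVED (in the tree and in print); this only
says that (N3-a) through subgroups of `Γ₂` cannot be the proof.  Lane record `P3-NILPOTENT.md` §28.
[cite: Grigorchuk1980, Theorem (every element of the group has finite order)] [cite: BartholdiErschler2012, §2 (standard generating set), Thm. 5.3] -/
theorem wreathZ_standardGens_not_cosetSteps [DecidableEq ↥wreathZ] (htor : ∀ g ∈ grigorchukGroup, IsOfFinOrder g)
    (Γ₀ : Subgroup ↥wreathZ) [Γ₀.FiniteIndex] (R : Finset ↥wreathZ)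
    (hRt : ∀ r ∈ R, ∀ r' ∈ R, ∀ a : Γ₀, (a : ↥wreathZ) * r = r' → r = r')
    (hRc : ∀ g : ↥wreathZ, ∃ a : Γ₀, ∃ r ∈ R, (a : ↥wreathZ) * r = g)
    (c : Γ₀ →* Multiplicative (Fin 2 → ℤ)) (N : ℕ) (hN : 1 ≤ N)
    (hstep : ∀ r ∈ R, ∀ (i : Fin 2) (σ : ℤˣ), ∃ x : ↥wreathZ,
      (x ∈ ({aW, bW, cW, dW, sW} : Finset ↥wreathZ) ∨ x⁻¹ ∈ ({aW, bW, cW, dW, sW} : Finset ↥wreathZ)) ∧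
      ∃ (a : Γ₀) (r' : ↥wreathZ), r' ∈ R ∧ r * x = (a : ↥wreathZ) * r' ∧ Multiplicative.toAdd (c a) = Pi.single i ((N : ℤ) * σ)) : False :=
  wreathZ_not_cosetSteps_of_torsion htor {aW, bW, cW, dW, sW}
    (fun x hx => by
      simp only [Finset.mem_insert, Finset.mem_singleton] at hx
      rcases hx with rfl | rfl | rfl | rfl | rfl
      · exact Or.inl rfl
      · exact Or.inl rfl
      · exact Or.inl rfl
      · exact Or.inl rfl
      · exact Or.inr rfl)
    Γ₀ R hRt hRc c N hN hstep

end Grigorchuk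

end Summit.CriticalPhenomena.PercolationContinuityZ3.Theorems.Transplant

end
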